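import Mathlib
import HarnessLib
import HarnessLib.Audit

/-!
# SoloInformed — algebraic functions on a set: closure properties (PRES-RAT(2), Phase III-1)

Solo programme `solo-KontsevichZagierPeriods-informed`, session s110.  The cube germs of the Ayoub
transfer (`SoloInformedCubeGerm`) carry the field
`∃ P ∈ ℚ[z₁, …, zₙ, T], P ≠ 0, ∀ z ∈ U, P(z, g z) = 0` ("`g` is algebraic over `ℚ(z)` on `U`").
So far every germ of the programme was `K`-rational; the straightening of curved
(Nash) boundary pieces in dimension `2` (PRES-RAT(2)) produces germs
`(P/Q)(z, A z + t (B z − A z)) · (B z − A z)` built from complex-analytic algebraic functions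
`A, B` (implicit functions of boundary polynomials).  This file isolates the algebraicity
predicate, `SoloInformedAlgOn U g`, and proves that it is closed under the ring operations,
inversion of non-vanishing functions and evaluation of polynomials with algebraic coefficients
(`SoloInformedAlgOn.add/mul/sub/neg/pow/inv/div/eval₂`), with the coordinate functions and
algebraic constants algebraic (`soloInformedAlgOn_coord`, `soloInformedAlgOn_const`).

Method: `ℚ[z₁, …, zₙ]` (a domain) acts on the function ring `U → ℂ` through the coordinate
functions (`soloInformedPolyFn`); under the algebra equivalence
`ℚ[z₁, …, zₙ, T] ≃ ℚ[z₁, …, zₙ][T]` singling out the LAST variable (`soloInformedSnocEquiv`,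
`finRotate` followed by `MvPolynomial.finSuccEquiv`) the predicate is Mathlib's
`IsAlgebraic ℚ[z] (g|_U)` (`soloInformedAlgOn_iff_isAlgebraic`), and Mathlib's
`IsAlgebraic.add/mul/invOf` over a domain apply.  No integrality, no fraction fields and no
transitivity are needed (the function ring has zero divisors; transitivity would need more).

References: J. Ayoub, EMS Newsl. 91 (2014), §2.2 Def. 9; Mathlib `RingTheory.Algebraic.Integral`.
-/

noncomputable section

open scoped BigOperators Polynomial
open Set

namespace Summit.KontsevichZagierPeriods.KontsevichZagierPeriods.Theorems

variable {n : ℕ}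

/-! ### The predicate -/

/-- `g` is **algebraic over `ℚ(z₁, …, zₙ)` on `U`**: some non-zero `P ∈ ℚ[z₁, …, zₙ, T]` has
`P(z, g z) = 0` for all `z ∈ U` (the last variable carries the value).  This is verbatim the
field `SoloInformedCubeGerm.algebraic`. [Ayoub 2014, Def. 9] -/
def SoloInformedAlgOn (U : Set (Fin n → ℂ)) (g : (Fin n → ℂ) → ℂ) : Prop :=
  ∃ P : MvPolynomial (Fin (n + 1)) ℚ, P ≠ 0 ∧
    ∀ z ∈ U, MvPolynomial.aeval (Fin.snoc z (g z)) P = 0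

/-- Monotonicity in the set. -/
theorem SoloInformedAlgOn.mono {U V : Set (Fin n → ℂ)} {g : (Fin n → ℂ) → ℂ}
    (h : SoloInformedAlgOn U g) (hVU : V ⊆ U) : SoloInformedAlgOn V g := by
  obtain ⟨P, hP, hz⟩ := h
  exact ⟨P, hP, fun z hz' => hz z (hVU hz')⟩

/-- Only the values on `U` matter. -/
theorem SoloInformedAlgOn.congr {U : Set (Fin n → ℂ)} {g g' : (Fin n → ℂ) → ℂ}
    (h : SoloInformedAlgOn U g) (hgg' : EqOn g g' U) : SoloInformedAlgOn U g' := by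
  obtain ⟨P, hP, hz⟩ := h
  refine ⟨P, hP, fun z hz' => ?_⟩
  rw [← hgg' hz']
  exact hz z hz'

/-! ### `ℚ[z, T] ≃ ℚ[z][T]`, last variable distinguished -/

/-- The algebra equivalence `ℚ[z₁, …, zₙ, T] ≃ ℚ[z₁, …, zₙ][T]` making the LAST variable the
polynomial variable: rotate the last index to the front, then `MvPolynomial.finSuccEquiv`. -/
def soloInformedSnocEquiv (n : ℕ) :
    MvPolynomial (Fin (n + 1)) ℚ ≃ₐ[ℚ] Polynomial (MvPolynomial (Fin n) ℚ) :=
  (MvPolynomial.renameEquiv ℚ (finRotate (n + 1))).trans (MvPolynomial.finSuccEquiv ℚ n)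

/-- The last variable goes to `T`. -/
theorem soloInformedSnocEquiv_X_last (n : ℕ) :
    soloInformedSnocEquiv n (MvPolynomial.X (Fin.last n)) = Polynomial.X := by
  simp [soloInformedSnocEquiv, MvPolynomial.renameEquiv_apply, MvPolynomial.rename_X,
    MvPolynomial.finSuccEquiv_X_zero]

/-- The other variables go to constants. -/
theorem soloInformedSnocEquiv_X_castSucc (n : ℕ) (i : Fin n) :
    soloInformedSnocEquiv n (MvPolynomial.X (Fin.castSucc i)) = Polynomial.C (MvPolynomial.X i) := by
  have h : finRotate (n + 1) (Fin.castSucc i) = i.succ := by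
    rw [finRotate_apply, Fin.coeSucc_eq_succ]
  simp [soloInformedSnocEquiv, MvPolynomial.renameEquiv_apply, MvPolynomial.rename_X, h,
    MvPolynomial.finSuccEquiv_X_succ]

/-- **Evaluation identity**: `P(z, y)` is the value at `y` of the one-variable polynomial
`(soloInformedSnocEquiv n P)` with coefficients evaluated at `z`. -/
theorem soloInformed_aeval_snoc_eq (P : MvPolynomial (Fin (n + 1)) ℚ) (z : Fin n → ℂ) (y : ℂ) :
    MvPolynomial.aeval (Fin.snoc z y) P =
      Polynomial.eval₂ (MvPolynomial.aeval z : MvPolynomial (Fin n) ℚ →ₐ[ℚ] ℂ).toRingHom y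
        (soloInformedSnocEquiv n P) := by
  set ψ : Polynomial (MvPolynomial (Fin n) ℚ) →ₐ[ℚ] ℂ :=
    Polynomial.eval₂AlgHom (MvPolynomial.aeval z) y (fun a => Commute.all _ _) with hψ
  have hφ : (MvPolynomial.aeval (Fin.snoc z y) : MvPolynomial (Fin (n + 1)) ℚ →ₐ[ℚ] ℂ) =
      ψ.comp (soloInformedSnocEquiv n : MvPolynomial (Fin (n + 1)) ℚ →ₐ[ℚ] _) := by
    apply MvPolynomial.algHom_ext
    intro i
    induction i using Fin.lastCases with
    | last =>
      simp [hψ, soloInformedSnocEquiv_X_last]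
    | cast i =>
      simp [hψ, soloInformedSnocEquiv_X_castSucc]
  have := congrArg (fun φ : MvPolynomial (Fin (n + 1)) ℚ →ₐ[ℚ] ℂ => φ P) hφ
  simpa [hψ] using this

/-! ### `ℚ[z]` acting on functions `U → ℂ` -/

/-- Evaluation of `ℚ[z₁, …, zₙ]` on `U`: `P ↦ (u ↦ P(u))`, a ring homomorphism into the function
ring `U → ℂ`. -/
def soloInformedPolyFn (U : Set (Fin n → ℂ)) : MvPolynomial (Fin n) ℚ →+* (U → ℂ) :=
  (MvPolynomial.aeval (R := ℚ) (S₁ := U → ℂ) fun i (u : U) => (u : Fin n → ℂ) i).toRingHom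

/-- Pointwise formula. -/
theorem soloInformedPolyFn_apply (U : Set (Fin n → ℂ)) (P : MvPolynomial (Fin n) ℚ) (u : U) :
    soloInformedPolyFn U P u = MvPolynomial.aeval (u : Fin n → ℂ) P := by
  have h := MvPolynomial.comp_aeval (R := ℚ) (f := fun i (u : U) => (u : Fin n → ℂ) i)
    (Pi.evalAlgHom ℚ (fun _ : U => ℂ) u)
  have := congrArg (fun φ : MvPolynomial (Fin n) ℚ →ₐ[ℚ] ℂ => φ P) h
  simpa [soloInformedPolyFn] using this

/-- Pointwise evaluation of a polynomial over `ℚ[z]` at a function. -/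
theorem soloInformed_eval₂_polyFn_apply (U : Set (Fin n → ℂ)) (γ : U → ℂ)
    (p : Polynomial (MvPolynomial (Fin n) ℚ)) (u : U) :
    (Polynomial.eval₂ (soloInformedPolyFn U) γ p) u =
      Polynomial.eval₂ (MvPolynomial.aeval (u : Fin n → ℂ) : MvPolynomial (Fin n) ℚ →ₐ[ℚ] ℂ).toRingHom
        (γ u) p := by
  have h := Polynomial.hom_eval₂ p (soloInformedPolyFn U) (Pi.evalRingHom (fun _ : U => ℂ) u) γ
  have hc : (Pi.evalRingHom (fun _ : U => ℂ) u).comp (soloInformedPolyFn U) =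
      (MvPolynomial.aeval (u : Fin n → ℂ) : MvPolynomial (Fin n) ℚ →ₐ[ℚ] ℂ).toRingHom := by
    ext P
    · simp
    · simp [soloInformedPolyFn_apply]
  rw [hc] at h
  simpa using h

/-- `γ : U → ℂ` is algebraic over `ℚ[z]` (acting by `soloInformedPolyFn`): a non-zero polynomial
relation with coefficients in `ℚ[z]`. [this work] -/
def SoloInformedFnAlgebraic (U : Set (Fin n → ℂ)) (γ : U → ℂ) : Prop :=
  ∃ p : Polynomial (MvPolynomial (Fin n) ℚ), p ≠ 0 ∧ Polynomial.eval₂ (soloInformedPolyFn U) γ p = 0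

/-- It is Mathlib's `IsAlgebraic` for the algebra structure `soloInformedPolyFn U`. -/
theorem soloInformedFnAlgebraic_iff (U : Set (Fin n → ℂ)) (γ : U → ℂ) :
    SoloInformedFnAlgebraic U γ ↔
      @IsAlgebraic (MvPolynomial (Fin n) ℚ) (U → ℂ) _ _ (soloInformedPolyFn U).toAlgebra γ := by
  letI : Algebra (MvPolynomial (Fin n) ℚ) (U → ℂ) := (soloInformedPolyFn U).toAlgebra
  simp only [SoloInformedFnAlgebraic, IsAlgebraic, Polynomial.aeval_def, RingHom.algebraMap_toAlgebra]

/-- **The bridge**: `SoloInformedAlgOn U g` iff `g|_U` is algebraic over `ℚ[z]`. -/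
theorem soloInformedAlgOn_iff (U : Set (Fin n → ℂ)) (g : (Fin n → ℂ) → ℂ) :
    SoloInformedAlgOn U g ↔ SoloInformedFnAlgebraic U fun u => g u := by
  constructor
  · rintro ⟨P, hP, hz⟩
    refine ⟨soloInformedSnocEquiv n P, by simpa using hP, ?_⟩
    funext u
    rw [soloInformed_eval₂_polyFn_apply, ← soloInformed_aeval_snoc_eq]
    exact hz u u.2
  · rintro ⟨p, hp, h⟩
    refine ⟨(soloInformedSnocEquiv n).symm p, by simpa using hp, fun z hz => ?_⟩
    rw [soloInformed_aeval_snoc_eq, AlgEquiv.apply_symm_apply]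
    have := congrFun h ⟨z, hz⟩
    rw [soloInformed_eval₂_polyFn_apply] at this
    simpa using this

/-- … and iff Mathlib's `IsAlgebraic`. -/
theorem soloInformedAlgOn_iff_isAlgebraic (U : Set (Fin n → ℂ)) (g : (Fin n → ℂ) → ℂ) :
    SoloInformedAlgOn U g ↔
      @IsAlgebraic (MvPolynomial (Fin n) ℚ) (U → ℂ) _ _ (soloInformedPolyFn U).toAlgebra
        fun u => g u :=
  (soloInformedAlgOn_iff U g).trans (soloInformedFnAlgebraic_iff U _)

/-! ### Closure properties -/

namespace SoloInformedAlgOn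

variable {U : Set (Fin n → ℂ)} {g h : (Fin n → ℂ) → ℂ}

/-- Sums of algebraic functions are algebraic. -/
theorem add (hg : SoloInformedAlgOn U g) (hh : SoloInformedAlgOn U h) :
    SoloInformedAlgOn U fun z => g z + h z := by
  letI : Algebra (MvPolynomial (Fin n) ℚ) (U → ℂ) := (soloInformedPolyFn U).toAlgebra
  rw [soloInformedAlgOn_iff_isAlgebraic] at hg hh ⊢
  exact hg.add hh

/-- Products of algebraic functions are algebraic. -/
theorem mul (hg : SoloInformedAlgOn U g) (hh : SoloInformedAlgOn U h) :
    SoloInformedAlgOn U fun z => g z * h z := by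
  letI : Algebra (MvPolynomial (Fin n) ℚ) (U → ℂ) := (soloInformedPolyFn U).toAlgebra
  rw [soloInformedAlgOn_iff_isAlgebraic] at hg hh ⊢
  exact hg.mul hh

/-- Negatives of algebraic functions are algebraic. -/
theorem neg (hg : SoloInformedAlgOn U g) : SoloInformedAlgOn U fun z => -g z := by
  letI : Algebra (MvPolynomial (Fin n) ℚ) (U → ℂ) := (soloInformedPolyFn U).toAlgebra
  rw [soloInformedAlgOn_iff_isAlgebraic] at hg ⊢
  exact hg.neg

/-- Differences of algebraic functions are algebraic. -/
theorem sub (hg : SoloInformedAlgOn U g) (hh : SoloInformedAlgOn U h) :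
    SoloInformedAlgOn U fun z => g z - h z := by
  letI : Algebra (MvPolynomial (Fin n) ℚ) (U → ℂ) := (soloInformedPolyFn U).toAlgebra
  rw [soloInformedAlgOn_iff_isAlgebraic] at hg hh ⊢
  exact hg.sub hh

/-- Powers of algebraic functions are algebraic. -/
theorem pow (hg : SoloInformedAlgOn U g) (k : ℕ) : SoloInformedAlgOn U fun z => g z ^ k := by
  letI : Algebra (MvPolynomial (Fin n) ℚ) (U → ℂ) := (soloInformedPolyFn U).toAlgebra
  rw [soloInformedAlgOn_iff_isAlgebraic] at hg ⊢
  exact hg.pow k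

/-- Inverses of NON-VANISHING algebraic functions are algebraic. -/
theorem inv (hg : SoloInformedAlgOn U g) (h0 : ∀ z ∈ U, g z ≠ 0) :
    SoloInformedAlgOn U fun z => (g z)⁻¹ := by
  letI : Algebra (MvPolynomial (Fin n) ℚ) (U → ℂ) := (soloInformedPolyFn U).toAlgebra
  rw [soloInformedAlgOn_iff_isAlgebraic] at hg ⊢
  letI : Invertible (fun u : U => g u) :=
    ⟨fun u => (g u)⁻¹, funext fun u => inv_mul_cancel₀ (h0 u u.2),
      funext fun u => mul_inv_cancel₀ (h0 u u.2)⟩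
  exact hg.invOf

/-- Quotients by non-vanishing algebraic functions are algebraic. -/
theorem div (hg : SoloInformedAlgOn U g) (hh : SoloInformedAlgOn U h) (h0 : ∀ z ∈ U, h z ≠ 0) :
    SoloInformedAlgOn U fun z => g z / h z := by
  simpa [div_eq_mul_inv] using hg.mul (hh.inv h0)

end SoloInformedAlgOn

/-- The coordinate functions are algebraic (`T − zᵢ`). -/
theorem soloInformedAlgOn_coord (U : Set (Fin n → ℂ)) (i : Fin n) :
    SoloInformedAlgOn U fun z => z i := by
  rw [soloInformedAlgOn_iff]
  refine ⟨Polynomial.X - Polynomial.C (MvPolynomial.X i), Polynomial.X_sub_C_ne_zero _, ?_⟩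
  funext u
  rw [soloInformed_eval₂_polyFn_apply, Pi.zero_apply, Polynomial.eval₂_sub, Polynomial.eval₂_X,
    Polynomial.eval₂_C, AlgHom.toRingHom_eq_coe, AlgHom.coe_toRingHom, MvPolynomial.aeval_X, sub_self]

/-- Algebraic constants are algebraic functions (the minimal polynomial, coefficients in `ℚ`). -/
theorem soloInformedAlgOn_const (U : Set (Fin n → ℂ)) {c : ℂ} (hc : IsAlgebraic ℚ c) :
    SoloInformedAlgOn U fun _ => c := by
  obtain ⟨m, hm0, hm⟩ := hc
  rw [soloInformedAlgOn_iff]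
  refine ⟨m.map (algebraMap ℚ (MvPolynomial (Fin n) ℚ)), ?_, ?_⟩
  · exact (Polynomial.map_ne_zero_iff (MvPolynomial.C_injective (Fin n) ℚ)).2 hm0
  · funext u
    rw [soloInformed_eval₂_polyFn_apply, Polynomial.eval₂_map]
    have hcomp : ((MvPolynomial.aeval (u : Fin n → ℂ) : MvPolynomial (Fin n) ℚ →ₐ[ℚ] ℂ).toRingHom).comp
        (algebraMap ℚ (MvPolynomial (Fin n) ℚ)) = algebraMap ℚ ℂ := by
      ext q
      simp
    rw [hcomp, ← Polynomial.aeval_def, hm]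
    rfl

/-- **Polynomials in algebraic functions with algebraic coefficients are algebraic.** For a
coefficient map `f : K →+* ℂ` with algebraic values and algebraic `γⱼ`,
`z ↦ Q^f(γ₁ z, …, γₘ z)` is algebraic on `U`. -/
theorem SoloInformedAlgOn.eval₂ {K : Type*} [CommRing K] (f : K →+* ℂ)
    (hf : ∀ c : K, IsAlgebraic ℚ (f c)) (U : Set (Fin n → ℂ)) {m : ℕ}
    {γ : Fin m → (Fin n → ℂ) → ℂ} (hγ : ∀ j, SoloInformedAlgOn U (γ j))
    (Q : MvPolynomial (Fin m) K) :
    SoloInformedAlgOn U fun z => MvPolynomial.eval₂ f (fun j => γ j z) Q := by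
  induction Q using MvPolynomial.induction_on with
  | C c => simpa using soloInformedAlgOn_const U (hf c)
  | add p q hp hq => simpa [MvPolynomial.eval₂_add] using hp.add hq
  | mul_X p j hp => simpa [MvPolynomial.eval₂_mul, MvPolynomial.eval₂_X] using hp.mul (hγ j)

end Summit.KontsevichZagierPeriods.KontsevichZagierPeriods.Theorems
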